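import Literature.MathematicalPhysics.QuantumFieldTheory.Balaban1983to89.B7Prop10InLambda

/-!
# `Balaban1983to89.B7Eq208Analytic` — T. Bałaban, *Averaging operations for lattice gauge theories*, Commun. Math. Phys. **98**
(1985) 17–51 [Balaban1985Averaging], Sect. F p. 50, **the sentence of (208): «ũ′ʲ are analytic functions of λ, and
Q′_j(u₁, λ) = (1/i) log ũ′ʲ, j ≦ k, (208) are analytic functions of λ also»**, AT A GENERAL (52) BACKGROUND over the concrete `ℤᵈ`
carrier of the `B7Prop1Explicit`/`B7Eq99Concrete`/`B7Prop10General` lineage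

statement-level skeleton of published theorems with citation tags; proofs where landed; nothing here is a claim about the Yang–Mills mass gap

PDF held: `paper:balaban1985-cmp98-averaging` (journal page = PDF page + 16); p. 50 read on the render
`b2b-balaban-ref1/pages/1985-cmp98-averaging/1985-cmp98-averaging-p034-x2.png`, pp. 45–46, 49 on `p029/p030/p033-x2.png` (AS IMAGES,
this unit, 2026-08-21).

CITATION HEADER (lean-in-tree rule).  Cell `lit-balaban` (HOME `run/shared/lean/pub/lit-balaban/`), unit `lit-balaban-r04` (B7 block
owner, gen 5; TAKING line HOME/STATUS.md 2026-08-21T05:57:34Z) — KERNEL PIECE for SKELETON row **`B7.Eq207`** (its member (208);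
decl of record for the sentence so far: the ABSTRACT field `B7Eq214.GaugeLinData.IsAnalyticQp`), companion of `B7Eq214General`
((213)–(214) @gen) and of r05's `B8Eq178Averages.Qnl` (= `Q′_j(u₁, λ)` of (208) in B8's vocabulary).  Downstream use in print:
[Balaban1985RegularSpaces] (1.124) p. 97, the Cauchy formula in an auxiliary complex parameter `τ` for `C′(λ + τλ₀)`.

PRINT (p. 50 [PDF 34], verbatim).  «The assumptions (176), (177) can be reformulated in terms of the functions `λ = (1/i) log u′`. If
we assume `|(D^η_{U₀}λ)(b)| < α₄, |λ(x)| < α₄, λ(x) ∈ 𝔤ᶜ, α₄ sufficiently small`, (207) then assumptions (176), (177) are satisfied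
with a constant `4α₄` instead of `α₄`. It is obvious from the definition of the averaging operations that `ũ′ʲ` are analytic
functions of `λ`, and `Q′_j(u₁, λ) = (1/i) log ũ′ʲ, j ≦ k`, (208) are analytic functions of `λ` also.»  Here (p. 45) `ũ′ʲ =
\overline{R₀u′u₁}ʲ(\overline{R₀u₁}ʲ)⁻¹` (178), defined inductively by (179), the averages being the twisted block averages (78)–(80)
at the averaged backgrounds `Ū₀ʲ`; `u₁ ∈ Λ_k(U₀, α₃)` ((166)–(167) p. 44); `U₀` satisfies (52).

WHAT THIS FILE PROVES (kernel, no `sorry`, standard axioms; all domain conditions displayed and then DISCHARGED from Proposition 10).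
Print's proof is the word «obvious from the definition of the averaging operations»: the averages are finite compositions of products,
inverses, conjugations by the (fixed) background transporters, `exp`, and the series logarithm (21) — analytic as long as every
logarithm is taken inside its disc `|· − 1| < 1`, which is what (166)–(167)/(203)–(204) guarantee.  We formalise exactly this.
* §0 `insSite` — insertion of finitely many SITE variables `(λ_x)_{x∈S} ∈ 𝔸^S` (`λ = 0`, `u′ = 1` off `S`), the site analogue of
  `B7Prop3Flat.insCfg`; `analyticAt_insSite`, `norm_insSite_le`.
* §1 ANALYTIC SITE FAMILIES `t ↦ v(t) : ℤᵈ → 𝔸ˣ` (`t` in any complex normed space `E`; hypothesis shape as in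
  `B7Prop7OneStepAnalytic`: value AND inverse analytic at `t₀` at every site): `analyticAt_site_expGauge_family` (`u′ = e^{λ(t)}`),
  `_mul_family`, `_const_family`; **`analyticAt_savg_family`** — the site average (78) `{g(x)}_{x∈B(y)} = g(y)exp[Σ L^{−d} log g(y)⁻¹g(x)]`
  and its inverse are analytic wherever the block quantities `g(y)⁻¹g(x)` at `t₀` lie in the disc of (21) (`MatrixLog.analyticAt_mlog`);
  `analyticAt_R0fun_family` (the rotation `(R_{0,y}v)(x) = R(V₀(Γ_{y,x}))v(x)` by FIXED transporters), **`analyticAt_R0avg_family`** ((78)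
  twisted).
* §2 **`analyticAt_uavg_family`** — the tower (79)/(80) `\overline{R₀u}ʲ`, `j ≤ k`, of an analytic family `u(t)` is analytic (values and
  inverses) provided the (167)-quantities of `u(t₀)` at the levels `j < k` are `< 1` in `‖· − 1‖`.
* §3 **`analyticAt_utilG_family`** — `ũ′ʲ[u′(t), u₁]` via (178) (`B8Eq178Averages.utilG_eq_uavg_mul_inv`: `ũ′ʲ = \overline{R₀u′u₁}ʲ·
  (\overline{R₀u₁}ʲ)⁻¹`, the second factor CONSTANT in `λ`); **`analyticAt_mlog_utilG_family`** — `log ũ′ʲ(z)` ((208); the unit `1/i` and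
  `λ ↦ iλ` are immaterial) under the extra disc condition `‖ũ′ʲ(z)[t₀] − 1‖ < 1`.
* §4 THE DOMAIN CONDITIONS FROM PROPOSITION 10 (`B7Prop10General.prop10_general'`, p05's (182)-split of `B7Prop10InLambda`): under the
  hypotheses of Prop. 10 at a general background the (167)-quantity of the product `u′u₁` at level `j < k` is within
  `(6/5)·4dα₄L^{j+1}η + α₃L^{j+1}η ≤ 1/25` of `1` (`prodLoop_le`, `prodLoop_lt_one`) and `‖ũ′ʲ − 1‖ ≤ C₆α₄ ≤ 1/10`.
* §5 THE SENTENCE OF (208): **`eq208_analyticAt`** (parametric: any site family `u′(t)` analytic at `t₀` with `u′(t₀)` satisfying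
  (176)/(177), level hypotheses of `prop10_general` ⇒ for all `j ≤ k`, `z`: `t ↦ ũ′ʲ(z)` and `t ↦ log ũ′ʲ(z)` analytic at `t₀`);
  **`eq208_analyticAt_of52`** (level hypotheses discharged by Proposition 2, `levels_of52`); **`eq208_analyticAt_of207`** (print's datum:
  `u′ = e^{λ(t)}`, `λ(t₀)` satisfying (207), hypotheses ⊆ those of `B7Eq214General.eq214_general_of207`); **`eq208_analyticOnNhd_ins`** /
  `utilG_analyticOnNhd_ins` (THE PRINTED LETTER on `𝔸^S`: `(λ_x)_{x∈S} ↦ Q′_j(u₁, λ)(z)`, resp. `ũ′ʲ(z)`, analytic on a neighbourhood of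
  every point of the (207)-domain); `analyticAt_Qnl_of207` (bridge to r05's `B8Eq178Averages.Qnl`); **`eq208_analyticAt_line`** (the form
  B8 (1.124) consumes: `τ ↦ Q′_j(u₁, λ + τλ₀)(z)` analytic at every `τ₀` with `λ + τ₀λ₀` in the (207)-domain).
READINGS (recorded; none is an objection to print).  (a) carrier: `𝔸` a complete normed `ℂ`-algebra with `‖1‖ = 1`, `U₀` with values in
an average-closed subgroup `G ⊂ U1` (Props. 1–2/10 lineage); `u₁` arbitrary units with (166)–(167) (no unitarity used); «λ(x) ∈ 𝔤ᶜ» =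
all of `𝔸`.  (b) «analytic functions of λ»: Fréchet-analytic (`AnalyticAt ℂ`) in finitely many inserted site variables / along any
analytic family; the infinite lattice carries no topology here (as in `B7Prop6GeneralAnalytic.prop4_general_analyticOnNhd_ins`).  (c)
smallness «α₄ sufficiently small» = the displayed hypotheses of `prop10_general` at `α₄ ↦ 4α₄` (the (207) ⇒ (176)/(177) loss), all
weaker than those of `eq214_general_of207`; `≤` for `<` in (176)/(177)/(166)/(167).  (d) `1/i`: the lineage's `λ := log u′`
(`B8Eq178Averages.Qnl` docstring); multiplication by `i` is a linear isomorphism, so analyticity statements are unchanged.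
REUSED BY NAME: `B7Prop10General.prop10_general' / levels_of52 / utilG / C6`, `B7Prop10InLambda.covBlock_of_covBondBd`,
`B8Eq178Averages.utilG_eq_uavg_mul_inv / Qnl / Qnl_eq_mlog_utilG`, `B7Eq99Concrete.savg / Sexp / R0fun / R0avg`, `B7Eq84Concrete.uavg`,
`B7Eq167Flat.InLambda`, `B7Prop9General.CovBondBd`, `B7Prop9Flat.SiteBd`, `B7Eq214.ineq176_of_207 / ineq177_of_207`, `B7Eq170Flat.cj`,
`B7Prop6Flat.norm_units_inv_sub_one_le`, `B7Prop6Bound.mul_sub_one_norm_le`, `MatrixLog.analyticAt_mlog`, Mathlib `NormedSpace.exp_analytic`.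
Unit `lit-balaban-r04` (gen 5), 2026-08-21.

[cite: Balaban1985Averaging, (208) p.50, (207) p.50, (178)–(179) p.45, (78)–(80) p.30, (166)–(167) p.44, Proposition 10 p.50]
-/

noncomputable section

open scoped BigOperators
open NormedSpace Finset

namespace Literature.MathematicalPhysics.QuantumFieldTheory.Balaban1983to89.B7Eq208Analytic

open B7Prop1Explicit B7Prop2Explicit MatrixLog B7Eq92Concrete B7Eq99Concrete B7Eq84Concrete B7Eq167Flat B7Prop9Flat
  B7Prop9General B7Prop10General B7Prop10InLambda
open B7Prop10Flat (siteBd_mono one_le_C5)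
open B7Eq170Flat (cj cj_apply val_Rc_eq_cj)
open B7Prop6Flat (norm_units_inv_sub_one_le)

-- `Site` alone would resolve to the torus sites of `Setup.lean`; re-export the `ℤ^d` sites of `B7Prop1Explicit`.
export B7Prop1Explicit (Site)

variable {d : ℕ}

/-! ## §0 Insertion of finitely many site variables -/

section Ins

variable {𝔸 : Type*} [NormedRing 𝔸] [NormedAlgebra ℂ 𝔸]

/-- INSERTION OF FINITELY MANY SITE VARIABLES: the site function on `ℤᵈ` equal to `a_x` at the sites `x` of a finite set `S` and to
`0` elsewhere (so `u′ = e^{λ} = 1` off `S`).  Print's «functions `λ = (1/i) log u′`», «analytic functions of `λ`» (p. 50) read on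
the coordinates `(λ_x)_{x∈S} ∈ 𝔸^S`; the site analogue of `B7Prop3Flat.insCfg`. [cite: Balaban1985Averaging, (207)–(208) p.50] -/
def insSite (S : Finset (Site d)) (a : S → 𝔸) : Site d → 𝔸 :=
  fun x => if h : x ∈ S then a ⟨x, h⟩ else 0

omit [NormedAlgebra ℂ 𝔸] in
/-- `insSite_of_mem`: on `S` the inserted function is the coordinate. [cite: Balaban1985Averaging, (207)–(208) p.50] -/
theorem insSite_of_mem (S : Finset (Site d)) (a : S → 𝔸) {x : Site d} (h : x ∈ S) : insSite S a x = a ⟨x, h⟩ := by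
  simp only [insSite, h, dite_true]

omit [NormedAlgebra ℂ 𝔸] in
/-- `insSite_of_not_mem`: off `S` the inserted function vanishes. [cite: Balaban1985Averaging, (207)–(208) p.50] -/
theorem insSite_of_not_mem (S : Finset (Site d)) (a : S → 𝔸) {x : Site d} (h : x ∉ S) : insSite S a x = 0 := by
  simp only [insSite, h, dite_false]

/-- Each site value of the inserted function is an analytic (coordinate or zero) function of `a ∈ 𝔸^S` (the coordinates in which
«analytic functions of λ» is read). [cite: Balaban1985Averaging, (207)–(208) p.50] (elementary API; our proof) -/
theorem analyticAt_insSite (S : Finset (Site d)) (x : Site d) (a₀ : S → 𝔸) :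
    AnalyticAt ℂ (fun a : S → 𝔸 => insSite S a x) a₀ := by
  by_cases h : x ∈ S
  · simp only [insSite, h, dite_true]
    exact (ContinuousLinearMap.proj (R := ℂ) (φ := fun _ : S => 𝔸) ⟨x, h⟩).analyticAt a₀
  · simp only [insSite, h, dite_false]
    exact analyticAt_const

omit [NormedAlgebra ℂ 𝔸] in
/-- `‖(insSite S a)(x)‖ ≤ ‖a‖` (sup norm on `𝔸^S`; «|λ(x)| < α₄» on `S`). [cite: Balaban1985Averaging, (207) p.50] (elementary API; our proof) -/
theorem norm_insSite_le (S : Finset (Site d)) (a : S → 𝔸) (x : Site d) : ‖insSite S a x‖ ≤ ‖a‖ := by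
  by_cases h : x ∈ S
  · simp only [insSite, h, dite_true]; exact norm_le_pi_norm a _
  · simp only [insSite, h, dite_false, norm_zero]; exact norm_nonneg _

end Ins

/-! ## §1 Analytic site families through the site averages (78) -/

section Family

variable {𝔸 : Type*} [NormedRing 𝔸] [NormedAlgebra ℂ 𝔸] [CompleteSpace 𝔸]
variable {E : Type*} [NormedAddCommGroup E] [NormedSpace ℂ E]

/-- the gauge function `u′ = e^{λ(t)}` of a sitewise-analytic `λ` and its inverse are sitewise analytic in `t` (print: `u′ = e^{iλ}`,
`λ ∈ 𝔤ᶜ`). [cite: Balaban1985Averaging, (207)–(208) p.50] -/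
theorem analyticAt_site_expGauge_family (lam : E → Site d → 𝔸) {t₀ : E}
    (hlam : ∀ x, AnalyticAt ℂ (fun t => lam t x) t₀) (x : Site d) :
    AnalyticAt ℂ (fun t => ((expUnit (lam t x) : 𝔸ˣ) : 𝔸)) t₀ ∧
      AnalyticAt ℂ (fun t => (((expUnit (lam t x))⁻¹ : 𝔸ˣ) : 𝔸)) t₀ := by
  refine ⟨?_, ?_⟩
  · simp only [val_expUnit]
    exact (exp_analytic _).fun_comp_of_eq (hlam x) rfl
  · simp only [val_inv_expUnit, val_expUnit]
    exact (exp_analytic _).fun_comp_of_eq (hlam x).neg rfl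

omit [CompleteSpace 𝔸] in
/-- products of sitewise-analytic unit families — print's `v′v₁`, `u′u₁` — are sitewise analytic (values and inverses).
[cite: Balaban1985Averaging, (178) p.45, (181) p.46] -/
theorem analyticAt_site_mul_family {v w : E → Site d → 𝔸ˣ} {t₀ : E}
    (hv : ∀ x, AnalyticAt ℂ (fun t => ((v t x : 𝔸ˣ) : 𝔸)) t₀ ∧ AnalyticAt ℂ (fun t => (((v t x)⁻¹ : 𝔸ˣ) : 𝔸)) t₀)
    (hw : ∀ x, AnalyticAt ℂ (fun t => ((w t x : 𝔸ˣ) : 𝔸)) t₀ ∧ AnalyticAt ℂ (fun t => (((w t x)⁻¹ : 𝔸ˣ) : 𝔸)) t₀)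
    (x : Site d) :
    AnalyticAt ℂ (fun t => (((v t * w t) x : 𝔸ˣ) : 𝔸)) t₀ ∧
      AnalyticAt ℂ (fun t => ((((v t * w t) x)⁻¹ : 𝔸ˣ) : 𝔸)) t₀ := by
  refine ⟨?_, ?_⟩
  · simp only [Pi.mul_apply, Units.val_mul]
    exact (hv x).1.fun_mul (hw x).1
  · simp only [Pi.mul_apply, mul_inv_rev, Units.val_mul]
    exact (hw x).2.fun_mul (hv x).2

omit [CompleteSpace 𝔸] in
/-- a constant gauge function (the fixed `u₁`, `v₁`) is a sitewise-analytic family. [cite: Balaban1985Averaging, (178) p.45] -/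
theorem analyticAt_site_const_family (u₁ : Site d → 𝔸ˣ) (t₀ : E) (x : Site d) :
    AnalyticAt ℂ (fun _ : E => ((u₁ x : 𝔸ˣ) : 𝔸)) t₀ ∧ AnalyticAt ℂ (fun _ : E => (((u₁ x)⁻¹ : 𝔸ˣ) : 𝔸)) t₀ :=
  ⟨analyticAt_const, analyticAt_const⟩

/-- **the exponent of the site average (78)**, `S_g(y) = Σ_{x∈B(y)} L^{−d} log g(y)⁻¹g(x)`, of a sitewise-analytic unit family `g(t)` is
analytic at `t₀` wherever the block quantities `g(y)⁻¹g(x)` at `t₀` lie in the disc of the series logarithm (21) (p. 21: «both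
functions are analytic functions of complex matrices X»). [cite: Balaban1985Averaging, (78) p.30, (21) p.21] -/
theorem analyticAt_Sexp_family {g : E → Site d → 𝔸ˣ} {t₀ : E}
    (hg : ∀ x, AnalyticAt ℂ (fun t => ((g t x : 𝔸ˣ) : 𝔸)) t₀ ∧ AnalyticAt ℂ (fun t => (((g t x)⁻¹ : 𝔸ˣ) : 𝔸)) t₀)
    (L : ℕ) (y : Site d)
    (hloop : ∀ r : Fin d → Fin L, ‖((((g t₀ y)⁻¹ * g t₀ (y + boxVec L r) : 𝔸ˣ)) : 𝔸) - 1‖ < 1) :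
    AnalyticAt ℂ (fun t => Sexp L (g t) y) t₀ := by
  simp only [Sexp_apply]
  refine Finset.analyticAt_fun_sum _ fun r _ => ?_
  have hprod : AnalyticAt ℂ (fun t => ((((g t y)⁻¹ * g t (y + boxVec L r) : 𝔸ˣ)) : 𝔸)) t₀ := by
    simp only [Units.val_mul]
    exact (hg y).2.fun_mul (hg _).1
  exact ((analyticAt_mlog (hloop r)).fun_comp_of_eq hprod rfl).fun_const_smul

/-- **the site average (78)** `{g(x)}_{x∈B(y)} = g(y)·exp S_g(y)` of a sitewise-analytic unit family, and its inverse, are analytic at `t₀`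
(same disc condition). [cite: Balaban1985Averaging, (78) p.30, (21) p.21] -/
theorem analyticAt_savg_family {g : E → Site d → 𝔸ˣ} {t₀ : E}
    (hg : ∀ x, AnalyticAt ℂ (fun t => ((g t x : 𝔸ˣ) : 𝔸)) t₀ ∧ AnalyticAt ℂ (fun t => (((g t x)⁻¹ : 𝔸ˣ) : 𝔸)) t₀)
    (L : ℕ) (y : Site d)
    (hloop : ∀ r : Fin d → Fin L, ‖((((g t₀ y)⁻¹ * g t₀ (y + boxVec L r) : 𝔸ˣ)) : 𝔸) - 1‖ < 1) :
    AnalyticAt ℂ (fun t => ((savg L (g t) y : 𝔸ˣ) : 𝔸)) t₀ ∧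
      AnalyticAt ℂ (fun t => (((savg L (g t) y)⁻¹ : 𝔸ˣ) : 𝔸)) t₀ := by
  have hS := analyticAt_Sexp_family hg L y hloop
  refine ⟨?_, ?_⟩
  · simp only [savg_apply, Units.val_mul, val_expUnit]
    exact (hg y).1.fun_mul ((exp_analytic _).fun_comp_of_eq hS rfl)
  · simp only [savg_apply, mul_inv_rev, Units.val_mul, val_inv_expUnit, val_expUnit]
    exact ((exp_analytic _).fun_comp_of_eq hS.neg rfl).fun_mul (hg y).2

omit [CompleteSpace 𝔸] in
/-- **the rotation `(R_{0,y}v)(x) = R(V₀(Γ_{y,x}))v(x)`** (p. 27) of a sitewise-analytic family by the FIXED background transporters is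
sitewise analytic (values and inverses): conjugation by a constant unit is linear. [cite: Balaban1985Averaging, p.27 (display after (59)), (56) p.27] -/
theorem analyticAt_R0fun_family (V₀ : Site d → Fin d → 𝔸ˣ) (y : Site d) {v : E → Site d → 𝔸ˣ} {t₀ : E}
    (hv : ∀ x, AnalyticAt ℂ (fun t => ((v t x : 𝔸ˣ) : 𝔸)) t₀ ∧ AnalyticAt ℂ (fun t => (((v t x)⁻¹ : 𝔸ˣ) : 𝔸)) t₀)
    (x : Site d) :
    AnalyticAt ℂ (fun t => ((R0fun V₀ y (v t) x : 𝔸ˣ) : 𝔸)) t₀ ∧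
      AnalyticAt ℂ (fun t => (((R0fun V₀ y (v t) x)⁻¹ : 𝔸ˣ) : 𝔸)) t₀ := by
  refine ⟨?_, ?_⟩
  · simp only [R0fun_apply, Rc_apply, Units.val_mul]
    exact (analyticAt_const.fun_mul (hv x).1).fun_mul analyticAt_const
  · simp only [R0fun_apply, Rc_apply, mul_inv_rev, inv_inv, Units.val_mul]
    exact analyticAt_const.fun_mul ((hv x).2.fun_mul analyticAt_const)

/-- **the twisted site average (78) `(R̄₀v)(y)` at a fixed background** of a sitewise-analytic family, and its inverse, are analytic at
`t₀` provided the block quantities `v(y)⁻¹(R_{0,y}v)(x)` at `t₀` (the expressions (167)/(180)) lie in the disc of (21).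
[cite: Balaban1985Averaging, (78) p.30, (167) p.44, (180) p.46] -/
theorem analyticAt_R0avg_family (L : ℕ) (V₀ : Site d → Fin d → 𝔸ˣ) {v : E → Site d → 𝔸ˣ} {t₀ : E}
    (hv : ∀ x, AnalyticAt ℂ (fun t => ((v t x : 𝔸ˣ) : 𝔸)) t₀ ∧ AnalyticAt ℂ (fun t => (((v t x)⁻¹ : 𝔸ˣ) : 𝔸)) t₀)
    (y : Site d)
    (hloop : ∀ r : Fin d → Fin L,
      ‖((((v t₀ y)⁻¹ * Rc (hol V₀ y (treeWord (boxVec L r))) (v t₀ (y + boxVec L r)) : 𝔸ˣ)) : 𝔸) - 1‖ < 1) :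
    AnalyticAt ℂ (fun t => ((R0avg L V₀ (v t) y : 𝔸ˣ) : 𝔸)) t₀ ∧
      AnalyticAt ℂ (fun t => (((R0avg L V₀ (v t) y)⁻¹ : 𝔸ˣ) : 𝔸)) t₀ := by
  have hg := fun x => analyticAt_R0fun_family V₀ y hv x
  have hloop' : ∀ r : Fin d → Fin L,
      ‖((((R0fun V₀ y (v t₀) y)⁻¹ * R0fun V₀ y (v t₀) (y + boxVec L r) : 𝔸ˣ)) : 𝔸) - 1‖ < 1 := fun r => by
    rw [R0fun_self, R0fun_add]; exact hloop r
  simpa only [R0avg] using analyticAt_savg_family hg L y hloop'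

end Family

/-! ## §2 The tower (79)/(80) of an analytic family -/

section Tower

variable {𝔸 : Type*} [NormedRing 𝔸] [NormedAlgebra ℂ 𝔸] [CompleteSpace 𝔸]
variable {E : Type*} [NormedAddCommGroup E] [NormedSpace ℂ E]

/-- **the averages (79)/(80) `\overline{R₀u}ʲ`, `j ≤ k`, of a sitewise-analytic family `u(t)` at a fixed background are analytic at
`t₀`** (values and inverses), provided the (167)-quantities of `u(t₀)` — `\overline{R₀u}ʲ(x_{j+1})⁻¹(R̄ʲ_{0,x_{j+1}}\overline{R₀u}ʲ)(x_j)`,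
`x_j ∈ B(x_{j+1})`, `j < k`, exactly the arguments of the logarithms in the averaging step (p. 44: «we have to calculate a logarithm
of the expression in (167)») — lie in the disc `‖· − 1‖ < 1` of (21).  Induction on `j` with `analyticAt_R0avg_family` at the
averaged background `Ū₀ʲ`. [cite: Balaban1985Averaging, (79)–(80) p.30, (167) p.44, (208) p.50] -/
theorem analyticAt_uavg_family (L : ℕ) (U₀ : Site d → Fin d → 𝔸ˣ) {u : E → Site d → 𝔸ˣ} {t₀ : E}
    (hu : ∀ x, AnalyticAt ℂ (fun t => ((u t x : 𝔸ˣ) : 𝔸)) t₀ ∧ AnalyticAt ℂ (fun t => (((u t x)⁻¹ : 𝔸ˣ) : 𝔸)) t₀)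
    (k : ℕ)
    (hloop : ∀ j < k, ∀ (z : Site d) (r : Fin d → Fin L),
      ‖((((uavg L U₀ (u t₀) j ((L : ℤ) • z))⁻¹
          * Rc (hol (avgIter L U₀ j) ((L : ℤ) • z) (treeWord (boxVec L r)))
              (uavg L U₀ (u t₀) j ((L : ℤ) • z + boxVec L r)) : 𝔸ˣ)) : 𝔸) - 1‖ < 1) :
    ∀ j ≤ k, ∀ z : Site d,
      AnalyticAt ℂ (fun t => ((uavg L U₀ (u t) j z : 𝔸ˣ) : 𝔸)) t₀ ∧
        AnalyticAt ℂ (fun t => (((uavg L U₀ (u t) j z)⁻¹ : 𝔸ˣ) : 𝔸)) t₀ := by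
  intro j
  induction j with
  | zero => intro _ z; simpa only [uavg_zero] using hu z
  | succ j ih =>
    intro hjk z
    have hj : j < k := Nat.lt_of_succ_le hjk
    have h := analyticAt_R0avg_family L (avgIter L U₀ j) (v := fun t => uavg L U₀ (u t) j) (ih hj.le) ((L : ℤ) • z)
      (hloop j hj z)
    simpa only [uavg_succ] using h

end Tower

/-! ## §3 `ũ′ʲ` and `log ũ′ʲ` via (178) -/

section Util

variable {𝔸 : Type*} [NormedRing 𝔸] [NormOneClass 𝔸] [NormedAlgebra ℂ 𝔸] [CompleteSpace 𝔸]
variable {E : Type*} [NormedAddCommGroup E] [NormedSpace ℂ E]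

omit [NormOneClass 𝔸] in
/-- **«ũ′ʲ are analytic functions of λ»** in family form: for a sitewise-analytic `u′(t)`, a fixed `u₁` and a fixed background, every
`ũ′ʲ(z)[u′(t), u₁]` (`B7Prop10General.utilG`, (178)/(179)), `j ≤ k`, and its inverse are analytic at `t₀`, provided the (167)-quantities
of the PRODUCT `u′(t₀)u₁` at the levels `j < k` lie in the disc of (21).  By (178) `ũ′ʲ = \overline{R₀u′u₁}ʲ·(\overline{R₀u₁}ʲ)⁻¹`
(`B8Eq178Averages.utilG_eq_uavg_mul_inv`) — the second factor does not depend on `u′` — and §2 for the product family.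
[cite: Balaban1985Averaging, (208) p.50, (178)–(179) p.45] -/
theorem analyticAt_utilG_family (L : ℕ) (U₀ : Site d → Fin d → 𝔸ˣ) {u' : E → Site d → 𝔸ˣ} {t₀ : E}
    (hu' : ∀ x, AnalyticAt ℂ (fun t => ((u' t x : 𝔸ˣ) : 𝔸)) t₀ ∧ AnalyticAt ℂ (fun t => (((u' t x)⁻¹ : 𝔸ˣ) : 𝔸)) t₀)
    (u₁ : Site d → 𝔸ˣ) (k : ℕ)
    (hloop : ∀ j < k, ∀ (z : Site d) (r : Fin d → Fin L),
      ‖((((uavg L U₀ (u' t₀ * u₁) j ((L : ℤ) • z))⁻¹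
          * Rc (hol (avgIter L U₀ j) ((L : ℤ) • z) (treeWord (boxVec L r)))
              (uavg L U₀ (u' t₀ * u₁) j ((L : ℤ) • z + boxVec L r)) : 𝔸ˣ)) : 𝔸) - 1‖ < 1) :
    ∀ j ≤ k, ∀ z : Site d,
      AnalyticAt ℂ (fun t => ((utilG L U₀ (u' t) u₁ j z : 𝔸ˣ) : 𝔸)) t₀ ∧
        AnalyticAt ℂ (fun t => (((utilG L U₀ (u' t) u₁ j z)⁻¹ : 𝔸ˣ) : 𝔸)) t₀ := by
  intro j hj z
  have hprod := fun x => analyticAt_site_mul_family hu' (analyticAt_site_const_family u₁ t₀) x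
  obtain ⟨h1, h2⟩ := analyticAt_uavg_family L U₀ (u := fun t => u' t * u₁) hprod k hloop j hj z
  have hfun : ∀ t, utilG L U₀ (u' t) u₁ j z = uavg L U₀ (u' t * u₁) j z * (uavg L U₀ u₁ j z)⁻¹ := fun t => by
    rw [B8Eq178Averages.utilG_eq_uavg_mul_inv]
  refine ⟨?_, ?_⟩
  · simp only [hfun, Units.val_mul]
    exact h1.fun_mul analyticAt_const
  · simp only [hfun, mul_inv_rev, inv_inv, Units.val_mul]
    exact analyticAt_const.fun_mul h2

omit [NormOneClass 𝔸] in
/-- **«Q′_j(u₁, λ) = (1/i) log ũ′ʲ, j ≦ k, (208) are analytic functions of λ also»** in family form: under the hypotheses of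
`analyticAt_utilG_family` and the disc condition `‖ũ′ʲ(z)[t₀] − 1‖ < 1` ((204): `≤ C₅α₄`), `t ↦ log ũ′ʲ(z)[u′(t), u₁]` is analytic at
`t₀`. [cite: Balaban1985Averaging, (208) p.50, (204) p.49] -/
theorem analyticAt_mlog_utilG_family (L : ℕ) (U₀ : Site d → Fin d → 𝔸ˣ) {u' : E → Site d → 𝔸ˣ} {t₀ : E}
    (hu' : ∀ x, AnalyticAt ℂ (fun t => ((u' t x : 𝔸ˣ) : 𝔸)) t₀ ∧ AnalyticAt ℂ (fun t => (((u' t x)⁻¹ : 𝔸ˣ) : 𝔸)) t₀)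
    (u₁ : Site d → 𝔸ˣ) (k : ℕ)
    (hloop : ∀ j < k, ∀ (z : Site d) (r : Fin d → Fin L),
      ‖((((uavg L U₀ (u' t₀ * u₁) j ((L : ℤ) • z))⁻¹
          * Rc (hol (avgIter L U₀ j) ((L : ℤ) • z) (treeWord (boxVec L r)))
              (uavg L U₀ (u' t₀ * u₁) j ((L : ℤ) • z + boxVec L r)) : 𝔸ˣ)) : 𝔸) - 1‖ < 1)
    {j : ℕ} (hj : j ≤ k) {z : Site d} (hdisc : ‖((utilG L U₀ (u' t₀) u₁ j z : 𝔸ˣ) : 𝔸) - 1‖ < 1) :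
    AnalyticAt ℂ (fun t => mlog ((utilG L U₀ (u' t) u₁ j z : 𝔸ˣ) : 𝔸)) t₀ :=
  (analyticAt_mlog hdisc).fun_comp_of_eq (analyticAt_utilG_family L U₀ hu' u₁ k hloop j hj z).1 rfl

end Util

/-! ## §4 The domain conditions from Proposition 10 -/

section Domain

variable {𝔸 : Type*} [NormedRing 𝔸] [NormOneClass 𝔸] [NormedAlgebra ℂ 𝔸] [CompleteSpace 𝔸]

omit [NormOneClass 𝔸] [NormedAlgebra ℂ 𝔸] [CompleteSpace 𝔸] in
/-- (182) p. 46 as an identity of units: `(AB)⁻¹R(T)(A′B′) = R(B⁻¹)[A⁻¹R(T)A′]·[B⁻¹R(T)B′]` («(v′v₁)⁻¹(y)(R_{0,y}v′v₁)(x) =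
R(v₁⁻¹(y))[v′⁻¹(y)(R_{0,y}v′)(x)]·v₁⁻¹(y)(R_{0,y}v₁)(x)»). [cite: Balaban1985Averaging, (182) p.46] -/
theorem prod_cov_split (T A A' B B' : 𝔸ˣ) :
    (A * B)⁻¹ * Rc T (A' * B') = Rc B⁻¹ (A⁻¹ * Rc T A') * (B⁻¹ * Rc T B') := by
  simp only [Rc_apply, mul_inv_rev, inv_inv]
  group

omit [NormedAlgebra ℂ 𝔸] [CompleteSpace 𝔸] in
/-- the estimate behind (183): `‖R(B⁻¹)X·Y − 1‖ ≤ (6/5)a + b` when `‖B − 1‖ ≤ w ≤ 1/50`, `‖X − 1‖ ≤ a`, `‖Y − 1‖ ≤ b ≤ 1/50`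
(`R(B⁻¹)X − 1 = B⁻¹(X − 1)B`, `‖B‖ ≤ 1 + w`, `‖B⁻¹‖ ≤ 1 + 2w`). [cite: Balaban1985Averaging, (182)–(183) p.46] -/
theorem prod_loop_bound {B X Y : 𝔸ˣ} {w a b : ℝ} (hB : ‖(B : 𝔸) - 1‖ ≤ w) (hw : w ≤ 1 / 50)
    (hX : ‖(X : 𝔸) - 1‖ ≤ a) (hY : ‖(Y : 𝔸) - 1‖ ≤ b) (hb : b ≤ 1 / 50) :
    ‖(((Rc B⁻¹ X * Y : 𝔸ˣ)) : 𝔸) - 1‖ ≤ 6 / 5 * a + b := by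
  have hw0 : 0 ≤ w := (norm_nonneg _).trans hB
  have ha0 : 0 ≤ a := (norm_nonneg _).trans hX
  have hb0 : 0 ≤ b := (norm_nonneg _).trans hY
  have hBn : ‖(B : 𝔸)‖ ≤ 1 + w := by
    calc ‖(B : 𝔸)‖ = ‖((B : 𝔸) - 1) + 1‖ := by rw [sub_add_cancel]
      _ ≤ ‖(B : 𝔸) - 1‖ + ‖(1 : 𝔸)‖ := norm_add_le _ _
      _ ≤ w + 1 := by rw [norm_one]; linarith
      _ = 1 + w := by ring
  have hBi : ‖((B⁻¹ : 𝔸ˣ) : 𝔸)‖ ≤ 1 + 2 * w := by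
    have h := norm_units_inv_sub_one_le B (hB.trans (hw.trans (by norm_num)))
    calc ‖((B⁻¹ : 𝔸ˣ) : 𝔸)‖ = ‖(((B⁻¹ : 𝔸ˣ) : 𝔸) - 1) + 1‖ := by rw [sub_add_cancel]
      _ ≤ ‖((B⁻¹ : 𝔸ˣ) : 𝔸) - 1‖ + ‖(1 : 𝔸)‖ := norm_add_le _ _
      _ ≤ 2 * ‖(B : 𝔸) - 1‖ + 1 := by rw [norm_one]; linarith
      _ ≤ 1 + 2 * w := by linarith
  -- `R(B⁻¹)X − 1 = B⁻¹(X − 1)B`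
  have hRc : ‖(((Rc B⁻¹ X : 𝔸ˣ)) : 𝔸) - 1‖ ≤ 11 / 10 * a := by
    have e : (((Rc B⁻¹ X : 𝔸ˣ)) : 𝔸) - 1 = ((B⁻¹ : 𝔸ˣ) : 𝔸) * ((X : 𝔸) - 1) * (B : 𝔸) := by
      rw [Rc_apply, inv_inv, Units.val_mul, Units.val_mul, mul_sub, sub_mul, mul_one, Units.inv_mul]
    rw [e]
    have e2 : (1 + 2 * w) * a * (1 + w) = a + 3 * (w * a) + 2 * (w * w * a) := by ring
    have h1 : w * a ≤ 1 / 50 * a := mul_le_mul_of_nonneg_right hw ha0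
    have h2 : w * w * a ≤ 1 / 50 * (1 / 50) * a :=
      mul_le_mul_of_nonneg_right (mul_le_mul hw hw hw0 (by norm_num)) ha0
    calc ‖((B⁻¹ : 𝔸ˣ) : 𝔸) * ((X : 𝔸) - 1) * (B : 𝔸)‖
        ≤ ‖((B⁻¹ : 𝔸ˣ) : 𝔸)‖ * ‖(X : 𝔸) - 1‖ * ‖(B : 𝔸)‖ := by
          calc _ ≤ ‖((B⁻¹ : 𝔸ˣ) : 𝔸) * ((X : 𝔸) - 1)‖ * ‖(B : 𝔸)‖ := norm_mul_le _ _
            _ ≤ _ := by gcongr; exact norm_mul_le _ _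
      _ ≤ (1 + 2 * w) * a * (1 + w) := by gcongr
      _ = a + 3 * (w * a) + 2 * (w * w * a) := e2
      _ ≤ 11 / 10 * a := by linarith
  have hab : a * b ≤ a * (1 / 50) := mul_le_mul_of_nonneg_left hb ha0
  calc ‖(((Rc B⁻¹ X * Y : 𝔸ˣ)) : 𝔸) - 1‖
      ≤ (1 + ‖(((Rc B⁻¹ X : 𝔸ˣ)) : 𝔸) - 1‖) * (1 + ‖(Y : 𝔸) - 1‖) - 1 := by
        rw [Units.val_mul]; exact B7Prop6Bound.mul_sub_one_norm_le _ _
    _ ≤ (1 + 11 / 10 * a) * (1 + b) - 1 := by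
        have h0 := norm_nonneg ((((Rc B⁻¹ X : 𝔸ˣ)) : 𝔸) - 1)
        exact sub_le_sub_right (mul_le_mul (by linarith) (by linarith) (by positivity) (by positivity)) 1
    _ = 11 / 10 * a + b + 11 / 10 * (a * b) := by ring
    _ ≤ 6 / 5 * a + b := by linarith

/-- **THE (167)-QUANTITIES OF THE PRODUCT `u′u₁` UNDER PROPOSITION 10** (the (182)-split as in p05's `B7Prop10InLambda.inLambda_mul_
of_prop10_general`, kept SHARP): under the hypotheses of `B7Prop10General.prop10_general` (level backgrounds in `U1` with «`α₀` replaced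
by `2α₀(Lʲη)²`», (176)/(177) for `u′`, `u₁ ∈ Λ_k(U₀, α₃)`, explicit smallness), for every `j < k`, block corner `Lz` and block point
`Lz + r`: `‖\overline{R₀u′u₁}ʲ(Lz)⁻¹(R̄ʲ_{0,Lz}\overline{R₀u′u₁}ʲ)(Lz + r) − 1‖ ≤ (6/5)·4dα₄L^{j+1}η + α₃L^{j+1}η` — the `ũ′ʲ`-factor by
(203) summed along the tree contour (`covBlock_of_covBondBd`), the `ū₁ʲ`-factor by (167). [cite: Balaban1985Averaging, (182) p.46, (203) p.49, (167) p.44, (178) p.45] -/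
theorem prodLoop_le {L : ℕ} (hL : 2 ≤ L) {U₀ : Site d → Fin d → 𝔸ˣ} {k : ℕ} {u' u₁ : Site d → 𝔸ˣ}
    {α₀ α₃ α₄ η : ℝ}
    (hV : ∀ j < k, ∀ (x : Site d) (κ : Fin d), avgIter L U₀ j x κ ∈ U1 𝔸)
    (h52 : ∀ j < k, ∀ (x : Site d) (κ μ : Fin d), κ ≠ μ →
      ‖((hol (avgIter L U₀ j) x (plaqWord κ μ) : 𝔸ˣ) : 𝔸) - 1‖ ≤ 2 * α₀ * ((L : ℝ) ^ j * η) ^ 2)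
    (h176 : SiteBd u' α₄) (h177 : CovBondBd U₀ u' (α₄ * η)) (hu₁ : InLambda L U₀ u₁ k α₃ η)
    (hη : 0 ≤ η) (hk : (L : ℝ) ^ k * η ≤ 1) (hα₀ : 0 ≤ α₀) (hα₃ : 0 ≤ α₃) (hα₃' : α₃ ≤ 1 / 50) (hα₄ : 0 ≤ α₄)
    (hs₁ : 10 * C6 d * α₄ ≤ 1) (hs₂ : 3000 * ((d : ℝ) + 1) * L * α₄ ≤ 1) (hs₃ : C4G d L * (α₀ + α₃ + α₄) ≤ 1)
    (hs₄ : 1024 * ((d : ℝ) + 1) * ((d : ℝ) + 4) * L ^ 2 * α₀ ≤ 1) (hs₅ : 32 * ((d : ℝ) + 1) ^ 2 * C6 d * L ^ 2 * α₀ ≤ 1)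
    (hs₆ : 16 * d * C5' d * C6 d * (L : ℝ) ^ 2 * α₀ ≤ 1)
    {j : ℕ} (hj : j < k) (z : Site d) (r : Fin d → Fin L) :
    ‖((((uavg L U₀ (u' * u₁) j ((L : ℤ) • z))⁻¹
        * Rc (hol (avgIter L U₀ j) ((L : ℤ) • z) (treeWord (boxVec L r)))
            (uavg L U₀ (u' * u₁) j ((L : ℤ) • z + boxVec L r)) : 𝔸ˣ)) : 𝔸) - 1‖
      ≤ 6 / 5 * (4 * d * α₄ * ((L : ℝ) ^ (j + 1) * η)) + α₃ * ((L : ℝ) ^ (j + 1) * η) := by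
  have hL1 : 1 ≤ L := le_trans (by norm_num) hL
  have hLr : (1 : ℝ) ≤ L := by exact_mod_cast hL1
  have hd : (0 : ℝ) ≤ d := Nat.cast_nonneg d
  have hP := prop10_general' hL hV h52 h176 h177 hu₁ hη hk hα₀ hα₃ hα₃' hα₄ hs₁ hs₂ hs₃ hs₄ hs₅ hs₆
  -- (178): `\overline{R₀u′u₁}ʲ = ũ′ʲ·\overline{R₀u₁}ʲ`
  have hfun : uavg L U₀ (u' * u₁) j = utilG L U₀ u' u₁ j * uavg L U₀ u₁ j := by
    funext x
    rw [Pi.mul_apply, B8Eq178Averages.utilG_eq_uavg_mul_inv, inv_mul_cancel_right]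
  have ht : (L : ℝ) ^ (j + 1) * η ≤ 1 :=
    le_trans (mul_le_mul_of_nonneg_right (pow_le_pow_right₀ hLr (Nat.succ_le_of_lt hj)) hη) hk
  have ht0 : 0 ≤ (L : ℝ) ^ (j + 1) * η := by positivity
  -- the `ũ′ʲ`-factor: (203) summed along the tree contour
  have h203 : CovBondBd (avgIter L U₀ j) (utilG L U₀ u' u₁ j) (2 * α₄ * ((L : ℝ) ^ j * η)) := (hP j hj.le).1
  have hsmall : (d : ℝ) * L * (2 * α₄ * ((L : ℝ) ^ j * η)) ≤ 1 := by
    have e : (d : ℝ) * L * (2 * α₄ * ((L : ℝ) ^ j * η)) = 2 * d * α₄ * ((L : ℝ) ^ (j + 1) * η) := by ring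
    rw [e]
    have h2d : 2 * (d : ℝ) * α₄ ≤ 1 := by nlinarith
    calc 2 * (d : ℝ) * α₄ * ((L : ℝ) ^ (j + 1) * η) ≤ 1 * 1 := mul_le_mul h2d ht ht0 (by norm_num)
      _ = 1 := one_mul 1
  have hA := covBlock_of_covBondBd (hV j hj) h203 (by positivity) hsmall ((L : ℤ) • z) r
  have e : 2 * ((d : ℝ) * L * (2 * α₄ * ((L : ℝ) ^ j * η))) = 4 * d * α₄ * ((L : ℝ) ^ (j + 1) * η) := by ring
  rw [e] at hA
  -- the `ū₁ʲ`-factor: (167) and (166) for `u₁`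
  have hB : ‖((((uavg L U₀ u₁ j ((L : ℤ) • z))⁻¹
      * Rc (hol (avgIter L U₀ j) ((L : ℤ) • z) (treeWord (boxVec L r)))
          (uavg L U₀ u₁ j ((L : ℤ) • z + boxVec L r)) : 𝔸ˣ)) : 𝔸) - 1‖ ≤ α₃ * ((L : ℝ) ^ (j + 1) * η) := by
    have h := hu₁.2 j hj z r; rwa [mul_assoc] at h
  have hWy : ‖((uavg L U₀ u₁ j ((L : ℤ) • z) : 𝔸ˣ) : 𝔸) - 1‖ ≤ α₃ := hu₁.1 j hj.le _
  have hb : α₃ * ((L : ℝ) ^ (j + 1) * η) ≤ 1 / 50 := by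
    calc α₃ * ((L : ℝ) ^ (j + 1) * η) ≤ 1 / 50 * 1 := mul_le_mul hα₃' ht ht0 (by norm_num)
      _ = 1 / 50 := by norm_num
  rw [hfun, Pi.mul_apply, Pi.mul_apply, prod_cov_split]
  exact prod_loop_bound hWy hα₃' hA hB hb

/-- Under the hypotheses of Proposition 10 the (167)-quantities of `u′u₁` lie in the disc of (21): `≤ 1/25 < 1`
(`(6/5)·4dα₄ + α₃ ≤ 1/625 + 1/50`). [cite: Balaban1985Averaging, (182) p.46, (208) p.50] -/
theorem prodLoop_lt_one {L : ℕ} (hL : 2 ≤ L) {U₀ : Site d → Fin d → 𝔸ˣ} {k : ℕ} {u' u₁ : Site d → 𝔸ˣ}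
    {α₀ α₃ α₄ η : ℝ}
    (hV : ∀ j < k, ∀ (x : Site d) (κ : Fin d), avgIter L U₀ j x κ ∈ U1 𝔸)
    (h52 : ∀ j < k, ∀ (x : Site d) (κ μ : Fin d), κ ≠ μ →
      ‖((hol (avgIter L U₀ j) x (plaqWord κ μ) : 𝔸ˣ) : 𝔸) - 1‖ ≤ 2 * α₀ * ((L : ℝ) ^ j * η) ^ 2)
    (h176 : SiteBd u' α₄) (h177 : CovBondBd U₀ u' (α₄ * η)) (hu₁ : InLambda L U₀ u₁ k α₃ η)
    (hη : 0 ≤ η) (hk : (L : ℝ) ^ k * η ≤ 1) (hα₀ : 0 ≤ α₀) (hα₃ : 0 ≤ α₃) (hα₃' : α₃ ≤ 1 / 50) (hα₄ : 0 ≤ α₄)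
    (hs₁ : 10 * C6 d * α₄ ≤ 1) (hs₂ : 3000 * ((d : ℝ) + 1) * L * α₄ ≤ 1) (hs₃ : C4G d L * (α₀ + α₃ + α₄) ≤ 1)
    (hs₄ : 1024 * ((d : ℝ) + 1) * ((d : ℝ) + 4) * L ^ 2 * α₀ ≤ 1) (hs₅ : 32 * ((d : ℝ) + 1) ^ 2 * C6 d * L ^ 2 * α₀ ≤ 1)
    (hs₆ : 16 * d * C5' d * C6 d * (L : ℝ) ^ 2 * α₀ ≤ 1) :
    ∀ j < k, ∀ (z : Site d) (r : Fin d → Fin L),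
      ‖((((uavg L U₀ (u' * u₁) j ((L : ℤ) • z))⁻¹
          * Rc (hol (avgIter L U₀ j) ((L : ℤ) • z) (treeWord (boxVec L r)))
              (uavg L U₀ (u' * u₁) j ((L : ℤ) • z + boxVec L r)) : 𝔸ˣ)) : 𝔸) - 1‖ < 1 := by
  intro j hj z r
  have hL1 : 1 ≤ L := le_trans (by norm_num) hL
  have hLr : (1 : ℝ) ≤ L := by exact_mod_cast hL1
  have hd : (0 : ℝ) ≤ d := Nat.cast_nonneg d
  have h := prodLoop_le hL hV h52 h176 h177 hu₁ hη hk hα₀ hα₃ hα₃' hα₄ hs₁ hs₂ hs₃ hs₄ hs₅ hs₆ hj z r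
  have ht : (L : ℝ) ^ (j + 1) * η ≤ 1 :=
    le_trans (mul_le_mul_of_nonneg_right (pow_le_pow_right₀ hLr (Nat.succ_le_of_lt hj)) hη) hk
  have ht0 : 0 ≤ (L : ℝ) ^ (j + 1) * η := by positivity
  have hdα : (d : ℝ) * α₄ ≤ 1 / 3000 := by nlinarith
  refine lt_of_le_of_lt h ?_
  nlinarith [mul_nonneg (mul_nonneg hd hα₄) ht0, mul_nonneg hα₃ ht0]

/-- Under the hypotheses of Proposition 10, `ũ′ʲ(z)` lies in the disc of (21): (204) `‖ũ′ʲ − 1‖ ≤ C₆α₄ ≤ 1/10 < 1`.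
[cite: Balaban1985Averaging, (204) p.49, (208) p.50] -/
theorem utilG_disc {L : ℕ} (hL : 2 ≤ L) {U₀ : Site d → Fin d → 𝔸ˣ} {k : ℕ} {u' u₁ : Site d → 𝔸ˣ}
    {α₀ α₃ α₄ η : ℝ}
    (hV : ∀ j < k, ∀ (x : Site d) (κ : Fin d), avgIter L U₀ j x κ ∈ U1 𝔸)
    (h52 : ∀ j < k, ∀ (x : Site d) (κ μ : Fin d), κ ≠ μ →
      ‖((hol (avgIter L U₀ j) x (plaqWord κ μ) : 𝔸ˣ) : 𝔸) - 1‖ ≤ 2 * α₀ * ((L : ℝ) ^ j * η) ^ 2)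
    (h176 : SiteBd u' α₄) (h177 : CovBondBd U₀ u' (α₄ * η)) (hu₁ : InLambda L U₀ u₁ k α₃ η)
    (hη : 0 ≤ η) (hk : (L : ℝ) ^ k * η ≤ 1) (hα₀ : 0 ≤ α₀) (hα₃ : 0 ≤ α₃) (hα₃' : α₃ ≤ 1 / 50) (hα₄ : 0 ≤ α₄)
    (hs₁ : 10 * C6 d * α₄ ≤ 1) (hs₂ : 3000 * ((d : ℝ) + 1) * L * α₄ ≤ 1) (hs₃ : C4G d L * (α₀ + α₃ + α₄) ≤ 1)
    (hs₄ : 1024 * ((d : ℝ) + 1) * ((d : ℝ) + 4) * L ^ 2 * α₀ ≤ 1) (hs₅ : 32 * ((d : ℝ) + 1) ^ 2 * C6 d * L ^ 2 * α₀ ≤ 1)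
    (hs₆ : 16 * d * C5' d * C6 d * (L : ℝ) ^ 2 * α₀ ≤ 1) :
    ∀ j ≤ k, ∀ z : Site d, ‖((utilG L U₀ u' u₁ j z : 𝔸ˣ) : 𝔸) - 1‖ < 1 := by
  intro j hj z
  have hP := prop10_general' hL hV h52 h176 h177 hu₁ hη hk hα₀ hα₃ hα₃' hα₄ hs₁ hs₂ hs₃ hs₄ hs₅ hs₆
  have h : ‖((utilG L U₀ u' u₁ j z : 𝔸ˣ) : 𝔸) - 1‖ ≤ C6 d * α₄ := (hP j hj).2 z
  exact lt_of_le_of_lt h (by linarith)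

end Domain

/-! ## §5 The sentence of (208) -/

section Eq208

variable {𝔸 : Type*} [NormedRing 𝔸] [NormOneClass 𝔸] [NormedAlgebra ℂ 𝔸] [CompleteSpace 𝔸]
variable {E : Type*} [NormedAddCommGroup E] [NormedSpace ℂ E]

/-- **(208) AT A GENERAL BACKGROUND, parametric form** (p. 50: «It is obvious from the definition of the averaging operations that `ũ′ʲ`
are analytic functions of `λ`, and `Q′_j(u₁, λ) = (1/i) log ũ′ʲ, j ≦ k`, (208) are analytic functions of `λ` also»): for a
sitewise-analytic family of gauge functions `u′(t)` (`t` in any complex normed space `E`; e.g. `u′(t) = e^{λ(t)}`,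
`analyticAt_site_expGauge_family`) whose member `u′(t₀)` satisfies the hypotheses of Proposition 10 at a general background
(`B7Prop10General.prop10_general`: (176) `SiteBd (u′ t₀) α₄`, (177) `CovBondBd U₀ (u′ t₀) (α₄η)`, `u₁ ∈ Λ_k(U₀, α₃)`, the level
backgrounds `Ū₀ʲ`, `j < k`, in `U1` with «`α₀` replaced by `2α₀(Lʲη)²`», `L ≥ 2`, `0 ≤ η`, `Lᵏη ≤ 1`, explicit smallness), for every
`j ≤ k` and every site `z` of `Ω^{(j)}`: `t ↦ ũ′ʲ(z)[u′(t), u₁]` and `t ↦ log ũ′ʲ(z)[u′(t), u₁]` are analytic at `t₀`.  PROOF = print's: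
§§1–3 (composition of the averaging operations) with the disc conditions supplied by §4 (Proposition 10).
[cite: Balaban1985Averaging, (208) p.50, Proposition 10 p.50, (178)–(179) p.45] -/
theorem eq208_analyticAt {L : ℕ} (hL : 2 ≤ L) {U₀ : Site d → Fin d → 𝔸ˣ} {k : ℕ} {u' : E → Site d → 𝔸ˣ} {t₀ : E}
    (hu' : ∀ x, AnalyticAt ℂ (fun t => ((u' t x : 𝔸ˣ) : 𝔸)) t₀ ∧ AnalyticAt ℂ (fun t => (((u' t x)⁻¹ : 𝔸ˣ) : 𝔸)) t₀)
    {u₁ : Site d → 𝔸ˣ} {α₀ α₃ α₄ η : ℝ}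
    (hV : ∀ j < k, ∀ (x : Site d) (κ : Fin d), avgIter L U₀ j x κ ∈ U1 𝔸)
    (h52 : ∀ j < k, ∀ (x : Site d) (κ μ : Fin d), κ ≠ μ →
      ‖((hol (avgIter L U₀ j) x (plaqWord κ μ) : 𝔸ˣ) : 𝔸) - 1‖ ≤ 2 * α₀ * ((L : ℝ) ^ j * η) ^ 2)
    (h176 : SiteBd (u' t₀) α₄) (h177 : CovBondBd U₀ (u' t₀) (α₄ * η)) (hu₁ : InLambda L U₀ u₁ k α₃ η)
    (hη : 0 ≤ η) (hk : (L : ℝ) ^ k * η ≤ 1) (hα₀ : 0 ≤ α₀) (hα₃ : 0 ≤ α₃) (hα₃' : α₃ ≤ 1 / 50) (hα₄ : 0 ≤ α₄)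
    (hs₁ : 10 * C6 d * α₄ ≤ 1) (hs₂ : 3000 * ((d : ℝ) + 1) * L * α₄ ≤ 1) (hs₃ : C4G d L * (α₀ + α₃ + α₄) ≤ 1)
    (hs₄ : 1024 * ((d : ℝ) + 1) * ((d : ℝ) + 4) * L ^ 2 * α₀ ≤ 1) (hs₅ : 32 * ((d : ℝ) + 1) ^ 2 * C6 d * L ^ 2 * α₀ ≤ 1)
    (hs₆ : 16 * d * C5' d * C6 d * (L : ℝ) ^ 2 * α₀ ≤ 1) :
    ∀ j ≤ k, ∀ z : Site d,
      AnalyticAt ℂ (fun t => ((utilG L U₀ (u' t) u₁ j z : 𝔸ˣ) : 𝔸)) t₀ ∧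
        AnalyticAt ℂ (fun t => mlog ((utilG L U₀ (u' t) u₁ j z : 𝔸ˣ) : 𝔸)) t₀ := by
  have hloop := prodLoop_lt_one hL hV h52 h176 h177 hu₁ hη hk hα₀ hα₃ hα₃' hα₄ hs₁ hs₂ hs₃ hs₄ hs₅ hs₆
  have hdisc := utilG_disc hL hV h52 h176 h177 hu₁ hη hk hα₀ hα₃ hα₃' hα₄ hs₁ hs₂ hs₃ hs₄ hs₅ hs₆
  intro j hj z
  exact ⟨(analyticAt_utilG_family L U₀ hu' u₁ k hloop j hj z).1,
    analyticAt_mlog_utilG_family L U₀ hu' u₁ k hloop hj (hdisc j hj z)⟩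

/-- **(208) AT A GENERAL BACKGROUND UNDER (52)** — `eq208_analyticAt` with its level hypotheses DISCHARGED by Proposition 2
(`B7Prop10General.levels_of52`): for `U₀` with values in an average-closed subgroup `G ⊂ U1` (e.g. `unitaryUnits 𝔸`) satisfying (52)
`sup_p‖U₀(∂p) − 1‖ < α₀η²`, `η = L^{−k}`, `C₀α₀ ≤ ⅓`, `2α₀ ≤ c′₂`, a sitewise-analytic family `u′(t)` with `u′(t₀)` satisfying (176),
(177), and `u₁ ∈ Λ_k(U₀, α₃)`: `ũ′ʲ(z)` and `log ũ′ʲ(z)`, `j ≤ k`, are analytic at `t₀`.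
[cite: Balaban1985Averaging, (208) p.50, Proposition 10 p.50, Proposition 2 p.26] -/
theorem eq208_analyticAt_of52 {L : ℕ} (hL : 2 ≤ L) {G : Subgroup 𝔸ˣ} (hG : AvgClosed d L G) {U₀ : Site d → Fin d → 𝔸ˣ}
    (hU : ∀ x κ, U₀ x κ ∈ G) {k : ℕ} {u' : E → Site d → 𝔸ˣ} {t₀ : E}
    (hu' : ∀ x, AnalyticAt ℂ (fun t => ((u' t x : 𝔸ˣ) : 𝔸)) t₀ ∧ AnalyticAt ℂ (fun t => (((u' t x)⁻¹ : 𝔸ˣ) : 𝔸)) t₀)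
    {u₁ : Site d → 𝔸ˣ} {α₀ α₃ α₄ : ℝ}
    (hα : 0 < α₀) (hα3 : C0 d * α₀ ≤ 1 / 3) (hα2 : 2 * α₀ ≤ c2' d L)
    (h52 : pdev U₀ < α₀ * (((L : ℝ) ^ k)⁻¹) ^ 2)
    (h176 : SiteBd (u' t₀) α₄) (h177 : CovBondBd U₀ (u' t₀) (α₄ * ((L : ℝ) ^ k)⁻¹))
    (hu₁ : InLambda L U₀ u₁ k α₃ (((L : ℝ) ^ k)⁻¹))
    (hα₃ : 0 ≤ α₃) (hα₃' : α₃ ≤ 1 / 50) (hα₄ : 0 ≤ α₄)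
    (hs₁ : 10 * C6 d * α₄ ≤ 1) (hs₂ : 3000 * ((d : ℝ) + 1) * L * α₄ ≤ 1) (hs₃ : C4G d L * (α₀ + α₃ + α₄) ≤ 1)
    (hs₄ : 1024 * ((d : ℝ) + 1) * ((d : ℝ) + 4) * L ^ 2 * α₀ ≤ 1) (hs₅ : 32 * ((d : ℝ) + 1) ^ 2 * C6 d * L ^ 2 * α₀ ≤ 1)
    (hs₆ : 16 * d * C5' d * C6 d * (L : ℝ) ^ 2 * α₀ ≤ 1) :
    ∀ j ≤ k, ∀ z : Site d,
      AnalyticAt ℂ (fun t => ((utilG L U₀ (u' t) u₁ j z : 𝔸ˣ) : 𝔸)) t₀ ∧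
        AnalyticAt ℂ (fun t => mlog ((utilG L U₀ (u' t) u₁ j z : 𝔸ˣ) : 𝔸)) t₀ := by
  obtain ⟨hV, hP⟩ := levels_of52 hL hG hU k hα hα3 hα2 h52
  have hη : (0 : ℝ) ≤ ((L : ℝ) ^ k)⁻¹ := by positivity
  have hk : (L : ℝ) ^ k * ((L : ℝ) ^ k)⁻¹ ≤ 1 := by rw [mul_inv_cancel₀ (by positivity)]
  exact eq208_analyticAt hL hu' (fun j hj => hV j hj.le) (fun j hj => hP j hj.le) h176 h177 hu₁ hη hk hα.le hα₃ hα₃' hα₄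
    hs₁ hs₂ hs₃ hs₄ hs₅ hs₆

/-- (207) ⇒ (176), (177) «with a constant `4α₄` instead of `α₄`» for `u′ = e^{λ}` — `B7Eq214.ineq176_of_207` / `ineq177_of_207` read on
the lineage's `SiteBd` / `CovBondBd` (as inside `B7Eq214General.eq214_general_of207`). [cite: Balaban1985Averaging, (207) p.50, (176)–(177) p.45] -/
theorem siteBd_covBondBd_of207 {U₀ : Site d → Fin d → 𝔸ˣ} {lam : Site d → 𝔸} {α₄ η : ℝ} (hα₄ : α₄ ≤ 1 / 4) (hη : η ≤ 1)
    (h207a : ∀ (x : Site d) (κ : Fin d), ‖cj (U₀ x κ) (lam (x + e κ)) - lam x‖ < α₄ * η)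
    (h207b : ∀ x : Site d, ‖lam x‖ < α₄) :
    SiteBd (fun x => expUnit (lam x)) (4 * α₄) ∧ CovBondBd U₀ (fun x => expUnit (lam x)) (4 * α₄ * η) := by
  refine ⟨fun x => ?_, fun x κ => ?_⟩
  · show ‖((expUnit (lam x) : 𝔸ˣ) : 𝔸) - 1‖ ≤ 4 * α₄
    rw [val_expUnit]
    exact (B7Eq214.ineq176_of_207 (lam x) hα₄ (h207b x)).le
  · show ‖((((expUnit (lam x))⁻¹ * Rc (U₀ x κ) (expUnit (lam (x + e κ))) : 𝔸ˣ)) : 𝔸) - 1‖ ≤ 4 * α₄ * η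
    rw [Units.val_mul, val_inv_expUnit, val_Rc_eq_cj, val_expUnit, cj_apply]
    exact (B7Eq214.ineq177_of_207 (U₀ x κ) (lam x) (lam (x + e κ)) hα₄ hη (h207b x) (h207a x κ)).le

/-- **(208) IN PRINT'S DATUM (207), AT A GENERAL BACKGROUND** (p. 50: «If we assume `|(D^η_{U₀}λ)(b)| < α₄, |λ(x)| < α₄, λ(x) ∈ 𝔤ᶜ,
α₄ sufficiently small`, (207) then … `ũ′ʲ` are analytic functions of `λ`, and `Q′_j(u₁, λ) = (1/i) log ũ′ʲ, j ≦ k`, (208) are analytic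
functions of `λ` also»).  HERE: `U₀` with values in an average-closed subgroup `G ⊂ U1` satisfying (52) `sup_p‖U₀(∂p) − 1‖ < α₀η²`,
`η = L^{−k}`; a sitewise-analytic family of data `λ(t) : ℤᵈ → 𝔸` (`t ∈ E`, any complex normed space) whose member `λ(t₀)` satisfies (207)
`‖R(U_{0,b})λ(b₊) − λ(b₋)‖ < α₄η` (`= η|(D^η_{U₀}λ)(b)|`), `‖λ(x)‖ < α₄`; `u′(t) := e^{λ(t)}`; `u₁ ∈ Λ_k(U₀, α₃)`; «α₄ sufficiently small»
= the smallness of Proposition 10 at `α₄ ↦ 4α₄` (all of it implied by the hypotheses of `B7Eq214General.eq214_general_of207`).  THEN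
for all `j ≤ k`, `z`: `t ↦ ũ′ʲ(z)` and `t ↦ log ũ′ʲ(z) = Q′_j(u₁, λ(t))(z)` are analytic at `t₀`.
[cite: Balaban1985Averaging, (207)–(208) p.50, Proposition 10 p.50, Proposition 2 p.26] -/
theorem eq208_analyticAt_of207 {L : ℕ} (hL : 2 ≤ L) {G : Subgroup 𝔸ˣ} (hG : AvgClosed d L G) {U₀ : Site d → Fin d → 𝔸ˣ}
    (hU : ∀ x κ, U₀ x κ ∈ G) {k : ℕ} {lam : E → Site d → 𝔸} {t₀ : E}
    (hlam : ∀ x, AnalyticAt ℂ (fun t => lam t x) t₀)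
    {u₁ : Site d → 𝔸ˣ} {α₀ α₃ α₄ : ℝ}
    (hα : 0 < α₀) (hα3 : C0 d * α₀ ≤ 1 / 3) (hα2 : 2 * α₀ ≤ c2' d L)
    (h52 : pdev U₀ < α₀ * (((L : ℝ) ^ k)⁻¹) ^ 2)
    (h207a : ∀ (x : Site d) (κ : Fin d), ‖cj (U₀ x κ) (lam t₀ (x + e κ)) - lam t₀ x‖ < α₄ * ((L : ℝ) ^ k)⁻¹)
    (h207b : ∀ x : Site d, ‖lam t₀ x‖ < α₄)
    (hu₁ : InLambda L U₀ u₁ k α₃ (((L : ℝ) ^ k)⁻¹))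
    (hα₃ : 0 ≤ α₃) (hα₃' : α₃ ≤ 1 / 50)
    (hs₁ : 40 * C6 d * α₄ ≤ 1) (hs₂ : 12000 * ((d : ℝ) + 1) * L * α₄ ≤ 1) (hs₃ : C4G d L * (α₀ + α₃ + 4 * α₄) ≤ 1)
    (hs₄ : 1024 * ((d : ℝ) + 1) * ((d : ℝ) + 4) * L ^ 2 * α₀ ≤ 1) (hs₅ : 32 * ((d : ℝ) + 1) ^ 2 * C6 d * L ^ 2 * α₀ ≤ 1)
    (hs₆ : 16 * d * C5' d * C6 d * (L : ℝ) ^ 2 * α₀ ≤ 1) :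
    ∀ j ≤ k, ∀ z : Site d,
      AnalyticAt ℂ (fun t => ((utilG L U₀ (fun x => expUnit (lam t x)) u₁ j z : 𝔸ˣ) : 𝔸)) t₀ ∧
        AnalyticAt ℂ (fun t => mlog ((utilG L U₀ (fun x => expUnit (lam t x)) u₁ j z : 𝔸ˣ) : 𝔸)) t₀ := by
  have hL1 : 1 ≤ L := le_trans (by norm_num) hL
  have hLr : (1 : ℝ) ≤ L := by exact_mod_cast hL1
  have hC6 : (2 : ℝ) ≤ C6 d := by unfold C6; linarith [one_le_C5 (d := d)]
  have hα₄0 : 0 ≤ α₄ := le_of_lt (lt_of_le_of_lt (norm_nonneg _) (h207b 0))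
  have hα₄' : α₄ ≤ 1 / 4 := by
    have h1 : 2 * α₄ ≤ C6 d * α₄ := mul_le_mul_of_nonneg_right hC6 hα₄0
    linarith
  have hη1 : ((L : ℝ) ^ k)⁻¹ ≤ 1 := inv_le_one_of_one_le₀ (one_le_pow₀ hLr)
  obtain ⟨h176, h177⟩ := siteBd_covBondBd_of207 hα₄' hη1 h207a h207b
  have hu' := fun x => analyticAt_site_expGauge_family lam hlam x
  have hs₁' : 10 * C6 d * (4 * α₄) ≤ 1 := by linarith
  have hs₂' : 3000 * ((d : ℝ) + 1) * L * (4 * α₄) ≤ 1 := by linarith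
  exact eq208_analyticAt_of52 hL hG hU hu' hα hα3 hα2 h52 h176 h177 hu₁ hα₃ hα₃' (by positivity) hs₁' hs₂' hs₃ hs₄
    hs₅ hs₆

/-- **(208) IN B8's VOCABULARY**: under the hypotheses of `eq208_analyticAt_of207`, r05's `B8Eq178Averages.Qnl L U₀ u′ u₁ j z` — the
function `Q′_j(u₁, λ)(z) = log ũ′ʲ(z)` of (208)/(1.79) — is analytic at `t₀` along `u′ = e^{λ(t)}` (`Qnl_eq_mlog_utilG`).
[cite: Balaban1985Averaging, (208) p.50] -/
theorem analyticAt_Qnl_of207 {L : ℕ} (hL : 2 ≤ L) {G : Subgroup 𝔸ˣ} (hG : AvgClosed d L G) {U₀ : Site d → Fin d → 𝔸ˣ}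
    (hU : ∀ x κ, U₀ x κ ∈ G) {k : ℕ} {lam : E → Site d → 𝔸} {t₀ : E}
    (hlam : ∀ x, AnalyticAt ℂ (fun t => lam t x) t₀)
    {u₁ : Site d → 𝔸ˣ} {α₀ α₃ α₄ : ℝ}
    (hα : 0 < α₀) (hα3 : C0 d * α₀ ≤ 1 / 3) (hα2 : 2 * α₀ ≤ c2' d L)
    (h52 : pdev U₀ < α₀ * (((L : ℝ) ^ k)⁻¹) ^ 2)
    (h207a : ∀ (x : Site d) (κ : Fin d), ‖cj (U₀ x κ) (lam t₀ (x + e κ)) - lam t₀ x‖ < α₄ * ((L : ℝ) ^ k)⁻¹)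
    (h207b : ∀ x : Site d, ‖lam t₀ x‖ < α₄)
    (hu₁ : InLambda L U₀ u₁ k α₃ (((L : ℝ) ^ k)⁻¹))
    (hα₃ : 0 ≤ α₃) (hα₃' : α₃ ≤ 1 / 50)
    (hs₁ : 40 * C6 d * α₄ ≤ 1) (hs₂ : 12000 * ((d : ℝ) + 1) * L * α₄ ≤ 1) (hs₃ : C4G d L * (α₀ + α₃ + 4 * α₄) ≤ 1)
    (hs₄ : 1024 * ((d : ℝ) + 1) * ((d : ℝ) + 4) * L ^ 2 * α₀ ≤ 1) (hs₅ : 32 * ((d : ℝ) + 1) ^ 2 * C6 d * L ^ 2 * α₀ ≤ 1)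
    (hs₆ : 16 * d * C5' d * C6 d * (L : ℝ) ^ 2 * α₀ ≤ 1) :
    ∀ j ≤ k, ∀ z : Site d,
      AnalyticAt ℂ (fun t => B8Eq178Averages.Qnl L U₀ (fun x => expUnit (lam t x)) u₁ j z) t₀ := by
  intro j hj z
  simp only [B8Eq178Averages.Qnl_eq_mlog_utilG]
  exact (eq208_analyticAt_of207 hL hG hU hlam hα hα3 hα2 h52 h207a h207b hu₁ hα₃ hα₃' hs₁ hs₂ hs₃ hs₄ hs₅ hs₆ j hj z).2

/-- **(208), THE PRINTED LETTER on `𝔸^S`: «Q′_j(u₁, λ) … are analytic functions of λ».**  For every finite set `S` of sites, the data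
of `eq208_analyticAt_of207` (`U₀` `G`-valued with (52), `u₁ ∈ Λ_k(U₀, α₃)`, the displayed smallness), every `j ≤ k` and every site `z`:
the function `𝔸^S → 𝔸`, `(λ_x)_{x∈S} ↦ Q′_j(u₁, λ)(z) = log ũ′ʲ(z)` [`λ = λ_x` on `S`, `λ = 0` off `S`: `insSite`; `u′ = e^{λ}`], is
analytic on a neighbourhood of every point of the (207)-domain `{λ : |(D^η_{U₀}λ)(b)| < α₄, |λ(x)| < α₄}`.
[cite: Balaban1985Averaging, (207)–(208) p.50] -/
theorem eq208_analyticOnNhd_ins (S : Finset (Site d)) {L : ℕ} (hL : 2 ≤ L) {G : Subgroup 𝔸ˣ} (hG : AvgClosed d L G)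
    {U₀ : Site d → Fin d → 𝔸ˣ} (hU : ∀ x κ, U₀ x κ ∈ G) {k : ℕ} {u₁ : Site d → 𝔸ˣ} {α₀ α₃ α₄ : ℝ}
    (hα : 0 < α₀) (hα3 : C0 d * α₀ ≤ 1 / 3) (hα2 : 2 * α₀ ≤ c2' d L)
    (h52 : pdev U₀ < α₀ * (((L : ℝ) ^ k)⁻¹) ^ 2)
    (hu₁ : InLambda L U₀ u₁ k α₃ (((L : ℝ) ^ k)⁻¹))
    (hα₃ : 0 ≤ α₃) (hα₃' : α₃ ≤ 1 / 50)
    (hs₁ : 40 * C6 d * α₄ ≤ 1) (hs₂ : 12000 * ((d : ℝ) + 1) * L * α₄ ≤ 1) (hs₃ : C4G d L * (α₀ + α₃ + 4 * α₄) ≤ 1)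
    (hs₄ : 1024 * ((d : ℝ) + 1) * ((d : ℝ) + 4) * L ^ 2 * α₀ ≤ 1) (hs₅ : 32 * ((d : ℝ) + 1) ^ 2 * C6 d * L ^ 2 * α₀ ≤ 1)
    (hs₆ : 16 * d * C5' d * C6 d * (L : ℝ) ^ 2 * α₀ ≤ 1) {j : ℕ} (hj : j ≤ k) (z : Site d) :
    AnalyticOnNhd ℂ (fun a : S → 𝔸 => mlog ((utilG L U₀ (fun x => expUnit (insSite S a x)) u₁ j z : 𝔸ˣ) : 𝔸))
      {a | (∀ (x : Site d) (κ : Fin d), ‖cj (U₀ x κ) (insSite S a (x + e κ)) - insSite S a x‖ < α₄ * ((L : ℝ) ^ k)⁻¹) ∧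
        ∀ x : Site d, ‖insSite S a x‖ < α₄} := by
  intro a ha
  exact (eq208_analyticAt_of207 hL hG hU (lam := fun a' : S → 𝔸 => insSite S a') (fun x => analyticAt_insSite S x a) hα hα3
    hα2 h52 ha.1 ha.2 hu₁ hα₃ hα₃' hs₁ hs₂ hs₃ hs₄ hs₅ hs₆ j hj z).2

/-- **«ũ′ʲ are analytic functions of λ», THE PRINTED LETTER on `𝔸^S`**: same data, the function `(λ_x)_{x∈S} ↦ ũ′ʲ(z)` is analytic on
a neighbourhood of every point of the (207)-domain. [cite: Balaban1985Averaging, (207)–(208) p.50, (178)–(179) p.45] -/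
theorem utilG_analyticOnNhd_ins (S : Finset (Site d)) {L : ℕ} (hL : 2 ≤ L) {G : Subgroup 𝔸ˣ} (hG : AvgClosed d L G)
    {U₀ : Site d → Fin d → 𝔸ˣ} (hU : ∀ x κ, U₀ x κ ∈ G) {k : ℕ} {u₁ : Site d → 𝔸ˣ} {α₀ α₃ α₄ : ℝ}
    (hα : 0 < α₀) (hα3 : C0 d * α₀ ≤ 1 / 3) (hα2 : 2 * α₀ ≤ c2' d L)
    (h52 : pdev U₀ < α₀ * (((L : ℝ) ^ k)⁻¹) ^ 2)
    (hu₁ : InLambda L U₀ u₁ k α₃ (((L : ℝ) ^ k)⁻¹))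
    (hα₃ : 0 ≤ α₃) (hα₃' : α₃ ≤ 1 / 50)
    (hs₁ : 40 * C6 d * α₄ ≤ 1) (hs₂ : 12000 * ((d : ℝ) + 1) * L * α₄ ≤ 1) (hs₃ : C4G d L * (α₀ + α₃ + 4 * α₄) ≤ 1)
    (hs₄ : 1024 * ((d : ℝ) + 1) * ((d : ℝ) + 4) * L ^ 2 * α₀ ≤ 1) (hs₅ : 32 * ((d : ℝ) + 1) ^ 2 * C6 d * L ^ 2 * α₀ ≤ 1)
    (hs₆ : 16 * d * C5' d * C6 d * (L : ℝ) ^ 2 * α₀ ≤ 1) {j : ℕ} (hj : j ≤ k) (z : Site d) :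
    AnalyticOnNhd ℂ (fun a : S → 𝔸 => ((utilG L U₀ (fun x => expUnit (insSite S a x)) u₁ j z : 𝔸ˣ) : 𝔸))
      {a | (∀ (x : Site d) (κ : Fin d), ‖cj (U₀ x κ) (insSite S a (x + e κ)) - insSite S a x‖ < α₄ * ((L : ℝ) ^ k)⁻¹) ∧
        ∀ x : Site d, ‖insSite S a x‖ < α₄} := by
  intro a ha
  exact (eq208_analyticAt_of207 hL hG hU (lam := fun a' : S → 𝔸 => insSite S a') (fun x => analyticAt_insSite S x a) hα hα3
    hα2 h52 ha.1 ha.2 hu₁ hα₃ hα₃' hs₁ hs₂ hs₃ hs₄ hs₅ hs₆ j hj z).1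

/-- **(208) ALONG A COMPLEX LINE — the form [Balaban1985RegularSpaces] (1.124) p. 97 consumes** («⟨δC′(λ)/δλ, λ₀⟩ =
(2πi)⁻¹∮_{|τ|=r}dτ τ⁻²C′(λ + τλ₀)», `C′ = C′_j(u₁, ·)` of (213)): for fixed data `λ, λ₀ : ℤᵈ → 𝔸` and a point `τ₀ ∈ ℂ` with
`λ + τ₀λ₀` in the (207)-domain (the other data as in `eq208_analyticAt_of207`), `τ ↦ Q′_j(u₁, λ + τλ₀)(z) = log ũ′ʲ(z)[e^{λ + τλ₀}, u₁]`
is analytic at `τ₀`, for all `j ≤ k`, `z`. [cite: Balaban1985Averaging, (208) p.50, (213) p.50] -/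
theorem eq208_analyticAt_line {L : ℕ} (hL : 2 ≤ L) {G : Subgroup 𝔸ˣ} (hG : AvgClosed d L G) {U₀ : Site d → Fin d → 𝔸ˣ}
    (hU : ∀ x κ, U₀ x κ ∈ G) {k : ℕ} (lam lam₀ : Site d → 𝔸) {τ₀ : ℂ}
    {u₁ : Site d → 𝔸ˣ} {α₀ α₃ α₄ : ℝ}
    (hα : 0 < α₀) (hα3 : C0 d * α₀ ≤ 1 / 3) (hα2 : 2 * α₀ ≤ c2' d L)
    (h52 : pdev U₀ < α₀ * (((L : ℝ) ^ k)⁻¹) ^ 2)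
    (h207a : ∀ (x : Site d) (κ : Fin d),
      ‖cj (U₀ x κ) (lam (x + e κ) + τ₀ • lam₀ (x + e κ)) - (lam x + τ₀ • lam₀ x)‖ < α₄ * ((L : ℝ) ^ k)⁻¹)
    (h207b : ∀ x : Site d, ‖lam x + τ₀ • lam₀ x‖ < α₄)
    (hu₁ : InLambda L U₀ u₁ k α₃ (((L : ℝ) ^ k)⁻¹))
    (hα₃ : 0 ≤ α₃) (hα₃' : α₃ ≤ 1 / 50)
    (hs₁ : 40 * C6 d * α₄ ≤ 1) (hs₂ : 12000 * ((d : ℝ) + 1) * L * α₄ ≤ 1) (hs₃ : C4G d L * (α₀ + α₃ + 4 * α₄) ≤ 1)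
    (hs₄ : 1024 * ((d : ℝ) + 1) * ((d : ℝ) + 4) * L ^ 2 * α₀ ≤ 1) (hs₅ : 32 * ((d : ℝ) + 1) ^ 2 * C6 d * L ^ 2 * α₀ ≤ 1)
    (hs₆ : 16 * d * C5' d * C6 d * (L : ℝ) ^ 2 * α₀ ≤ 1) :
    ∀ j ≤ k, ∀ z : Site d,
      AnalyticAt ℂ (fun τ : ℂ => mlog ((utilG L U₀ (fun x => expUnit (lam x + τ • lam₀ x)) u₁ j z : 𝔸ˣ) : 𝔸)) τ₀ := by
  have hlam : ∀ x, AnalyticAt ℂ (fun τ : ℂ => lam x + τ • lam₀ x) τ₀ := fun x =>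
    analyticAt_const.add (analyticAt_id.smul analyticAt_const)
  intro j hj z
  exact (eq208_analyticAt_of207 hL hG hU (lam := fun τ : ℂ => fun x => lam x + τ • lam₀ x) hlam hα hα3 hα2 h52 h207a
    h207b hu₁ hα₃ hα₃' hs₁ hs₂ hs₃ hs₄ hs₅ hs₆ j hj z).2

end Eq208

end Literature.MathematicalPhysics.QuantumFieldTheory.Balaban1983to89.B7Eq208Analytic

end
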